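import Mathlib.Algebra.Polynomial.Bivariate
import Mathlib.Algebra.Polynomial.Expand
import Mathlib.FieldTheory.Perfect
import Mathlib.RingTheory.Polynomial.Basic
import Mathlib.Algebra.CharP.Algebra
import HarnessLib

/-!
# Partial derivatives of a bivariate polynomial; inseparable polynomials over a perfect field

Library file (theorems only) on `K[X][Y]`. The derivative `∂Φ/∂Y` of `Φ ∈ K[X][Y]` is Mathlib's
`derivative Φ`; the derivative `∂Φ/∂X` with respect to the inner variable is rendered as
`swap (derivative (swap Φ))` with Mathlib's `Polynomial.Bivariate.swap`. We prove:

* `coeff_swap_derivative_swap`: the coefficient of `Yⁱ` in `∂Φ/∂X` is the derivative of the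
  coefficient of `Yⁱ` in `Φ`; hence `∂Φ/∂X` has `Y`-degree `≤ deg_Y Φ`, and `< deg_Y Φ` when `Φ` is
  monic in `Y` (`natDegree_swap_derivative_swap_lt`), so that `Φ ∤ ∂Φ/∂X` unless `∂Φ/∂X = 0`;
  likewise `Φ ∤ ∂Φ/∂Y` unless `∂Φ/∂Y = 0` (`not_dvd_derivative_of_ne_zero`);
* `exists_pow_eq_of_derivative_eq_zero`: over a perfect field of characteristic `p`, if
  `∂Φ/∂Y = 0` and `∂Φ/∂X = 0` then `Φ = Ψ^p` for some `Ψ ∈ K[X][Y]` (`Φ ∈ K[X^p][Y^p]` and every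
  coefficient is a `p`-th power); consequently an irreducible `Φ` over a finite field has
  `∂Φ/∂Y ≠ 0` or `∂Φ/∂X ≠ 0` (`derivative_ne_zero_or_of_irreducible`).

These facts feed the bound for the number of singular points of an irreducible plane curve via
elimination (`PlaneCurveBezoutWeak.exists_eliminant` applied to `Φ` and a nonzero partial
derivative), in the two-sided Weil estimate for singular plane curves (Cafure–Matera 2006,
Lemma 5.1).

## References

* W. Fulton, *Algebraic Curves*, 3rd ed. 2008, §3.1 (multiple points; over a perfect field an
  irreducible curve has a nonzero partial derivative). [Fulton2008]
* A. Cafure, G. Matera, Finite Fields Appl. 12 (2006) 155–185, Lemma 5.1. [CafureMatera2006]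
-/

noncomputable section

open scoped Polynomial.Bivariate
open Polynomial

namespace Literature.NumberTheory.DiophantineGeometry.AlgFunctionField

universe u

variable {K : Type u} [Field K]

/-! ### The derivative with respect to the inner variable -/

/-- `∂/∂X` of a monomial `c(X) Yⁿ` is `c'(X) Yⁿ`. [folklore] -/
theorem swap_derivative_swap_monomial (n : ℕ) (c : K[X]) :
    Bivariate.swap (derivative (Bivariate.swap (monomial n c : K[X][Y]))) =
      C (derivative c) * X ^ n := by
  rw [Bivariate.swap_monomial, derivative_mul, derivative_C, mul_zero, add_zero,
    Polynomial.derivative_map, map_mul, Bivariate.swap_map_C, map_pow, ← map_pow,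
    Bivariate.swap_C, Polynomial.map_pow, Polynomial.map_X]

/-- **The coefficient of `Yⁱ` in `∂Φ/∂X` is `(coeff of Yⁱ in Φ)'`.** [folklore] -/
theorem coeff_swap_derivative_swap (Φ : K[X][Y]) (i : ℕ) :
    (Bivariate.swap (derivative (Bivariate.swap Φ))).coeff i = derivative (Φ.coeff i) := by
  induction Φ using Polynomial.induction_on' with
  | add p q hp hq => simp only [map_add, coeff_add, hp, hq]
  | monomial n c =>
    rw [swap_derivative_swap_monomial, coeff_C_mul_X_pow, coeff_monomial]
    by_cases h : n = i
    · subst h; simp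
    · rw [if_neg (Ne.symm h), if_neg h, derivative_zero]

/-- `∂Φ/∂X` has `Y`-degree at most that of `Φ`. [folklore] -/
theorem natDegree_swap_derivative_swap_le (Φ : K[X][Y]) :
    (Bivariate.swap (derivative (Bivariate.swap Φ))).natDegree ≤ Φ.natDegree := by
  refine natDegree_le_iff_coeff_eq_zero.2 fun N hN ↦ ?_
  rw [coeff_swap_derivative_swap, coeff_eq_zero_of_natDegree_lt hN, derivative_zero]

/-- The coefficients of `∂Φ/∂X` have `X`-degree at most those of `Φ`. [folklore] -/
theorem natDegree_coeff_swap_derivative_swap_le (Φ : K[X][Y]) (i : ℕ) :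
    ((Bivariate.swap (derivative (Bivariate.swap Φ))).coeff i).natDegree ≤ (Φ.coeff i).natDegree := by
  rw [coeff_swap_derivative_swap]
  exact (natDegree_derivative_le _).trans (Nat.sub_le _ _)

/-- For `Φ` monic in `Y`, `∂Φ/∂X` is zero or of `Y`-degree `< deg_Y Φ` (its coefficient of
`Y^{deg Φ}` is `1' = 0`). [folklore] -/
theorem natDegree_swap_derivative_swap_lt {Φ : K[X][Y]} (hm : Φ.Monic)
    (h0 : Bivariate.swap (derivative (Bivariate.swap Φ)) ≠ 0) :
    (Bivariate.swap (derivative (Bivariate.swap Φ))).natDegree < Φ.natDegree := by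
  rcases (natDegree_swap_derivative_swap_le Φ).lt_or_eq with h | h
  · exact h
  · exfalso
    apply h0
    have hlead : (Bivariate.swap (derivative (Bivariate.swap Φ))).leadingCoeff = 0 := by
      rw [leadingCoeff, h, coeff_swap_derivative_swap, ← Polynomial.leadingCoeff, hm.leadingCoeff,
        derivative_one]
    exact leadingCoeff_eq_zero.1 hlead

/-- For `Φ` of positive `Y`-degree, `Φ ∤ ∂Φ/∂Y` unless `∂Φ/∂Y = 0`. [folklore] -/
theorem not_dvd_derivative_of_ne_zero {Φ : K[X][Y]} (h0 : derivative Φ ≠ 0) :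
    ¬ Φ ∣ derivative Φ := by
  refine not_dvd_of_natDegree_lt h0 ?_
  have hpos : 0 < Φ.natDegree := by
    rw [Nat.pos_iff_ne_zero]
    intro h
    apply h0
    rw [eq_C_of_natDegree_eq_zero h, derivative_C]
  have := natDegree_derivative_lt (p := Φ) (by omega)
  exact this

/-- For `Φ` monic in `Y`, `Φ ∤ ∂Φ/∂X` unless `∂Φ/∂X = 0`. [folklore] -/
theorem not_dvd_swap_derivative_swap_of_ne_zero {Φ : K[X][Y]} (hm : Φ.Monic)
    (h0 : Bivariate.swap (derivative (Bivariate.swap Φ)) ≠ 0) :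
    ¬ Φ ∣ Bivariate.swap (derivative (Bivariate.swap Φ)) :=
  not_dvd_of_natDegree_lt h0 (natDegree_swap_derivative_swap_lt hm h0)

/-! ### Polynomials with both partial derivatives zero over a perfect field -/

section Perfect

variable (p : ℕ) [Fact p.Prime] [CharP K p] [PerfectRing K p]

/-- Over a perfect field of characteristic `p`, a polynomial `c ∈ K[X]` with `c' = 0` is a `p`-th
power. [folklore] -/
theorem exists_pow_eq_of_derivative_eq_zero₁ {c : K[X]} (hc : derivative c = 0) :
    ∃ e : K[X], e ^ p = c := by
  have hp0 : p ≠ 0 := (Fact.out : p.Prime).ne_zero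
  haveI : ExpChar K p := ExpChar.prime Fact.out
  refine ⟨(contract p c).map ((frobeniusEquiv K p).symm : K →+* K), ?_⟩
  rw [← map_frobenius_expand p, ← map_expand, Polynomial.map_map, frobenius_comp_frobeniusEquiv_symm,
    Polynomial.map_id, expand_contract p hc hp0]

/-- **Over a perfect field of characteristic `p`, a bivariate polynomial with `∂Φ/∂Y = 0` and
`∂Φ/∂X = 0` is a `p`-th power.** Proof: `Φ = Φ₁(X, Y^p)` (`∂Φ/∂Y = 0`), every coefficient of `Φ₁` has
zero derivative (`∂Φ/∂X = 0`) hence is a `p`-th power `e_j(X)^p`, and then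
`Φ = (∑ e_j(X) Y^j)^p` by the freshman's dream. [cite: Fulton2008, §3.1] -/
theorem exists_pow_eq_of_derivative_eq_zero {Φ : K[X][Y]} (h1 : derivative Φ = 0)
    (h2 : Bivariate.swap (derivative (Bivariate.swap Φ)) = 0) : ∃ Ψ : K[X][Y], Ψ ^ p = Φ := by
  classical
  have hp0 : p ≠ 0 := (Fact.out : p.Prime).ne_zero
  haveI : ExpChar K p := ExpChar.prime Fact.out
  -- `Φ = expand p Φ₁`
  set Φ₁ : K[X][Y] := contract p Φ with hΦ₁
  have hexp : expand K[X] p Φ₁ = Φ := expand_contract p h1 hp0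
  -- every coefficient of `Φ₁` has zero derivative, hence is a `p`-th power
  have hcoeff : ∀ j, derivative (Φ₁.coeff j) = 0 := fun j ↦ by
    rw [hΦ₁, coeff_contract hp0, ← coeff_swap_derivative_swap, h2, coeff_zero]
  choose e he using fun j ↦ exists_pow_eq_of_derivative_eq_zero₁ p (hcoeff j)
  -- `Ψ₁ := ∑ e_j Y^j` satisfies `Ψ₁.map frobenius = Φ₁`
  set Ψ₁ : K[X][Y] := ∑ j ∈ Φ₁.support, C (e j) * X ^ j with hΨ₁
  have hmap : Ψ₁.map (frobenius K[X] p) = Φ₁ := by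
    rw [hΨ₁, Polynomial.map_sum]
    conv_rhs => rw [as_sum_support_C_mul_X_pow Φ₁]
    refine Finset.sum_congr rfl fun j _ ↦ ?_
    rw [Polynomial.map_mul, Polynomial.map_pow, Polynomial.map_X, Polynomial.map_C, frobenius_def, he]
  refine ⟨Ψ₁, ?_⟩
  rw [← map_frobenius_expand p, map_expand, hmap, hexp]

end Perfect

/-- **An irreducible bivariate polynomial over a finite field has a nonzero partial derivative.**
(Finite fields are perfect; a `p`-th power `Ψ^p`, `p ≥ 2`, is not irreducible.)
[cite: Fulton2008, §3.1] -/
theorem derivative_ne_zero_or_of_irreducible [Finite K] {Φ : K[X][Y]} (hirr : Irreducible Φ) :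
    derivative Φ ≠ 0 ∨ Bivariate.swap (derivative (Bivariate.swap Φ)) ≠ 0 := by
  by_contra h
  rw [not_or, not_ne_iff, not_ne_iff] at h
  obtain ⟨h1, h2⟩ := h
  -- the characteristic `p` of the finite field `K` is a prime, and `K` is perfect
  obtain ⟨p, hchar⟩ := CharP.exists K
  have hp : p.Prime :=
    (CharP.char_is_prime_or_zero K p).resolve_right (CharP.char_ne_zero_of_finite K p)
  haveI : Fact p.Prime := ⟨hp⟩
  haveI : ExpChar K p := ExpChar.prime hp
  haveI : PerfectRing K p := PerfectField.toPerfectRing p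
  obtain ⟨Ψ, hΨ⟩ := exists_pow_eq_of_derivative_eq_zero p h1 h2
  -- `Φ = Ψ^p` with `p ≥ 2` is not irreducible
  have hΨu : ¬ IsUnit Ψ := fun hu ↦ hirr.not_isUnit (hΨ ▸ hu.pow p)
  have hfac : Φ = Ψ * Ψ ^ (p - 1) := by
    rw [← pow_succ', Nat.sub_add_cancel hp.one_le, hΨ]
  rcases hirr.isUnit_or_isUnit hfac with hu | hu
  · exact hΨu hu
  · have hp1 : p - 1 ≠ 0 := by have := hp.two_le; omega
    exact hΨu ((isUnit_pow_iff hp1).1 hu)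

end Literature.NumberTheory.DiophantineGeometry.AlgFunctionField

end
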